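import Literature.AlgebraicGeometry.Motives.HodgeStructureLefschetzGroupPoints
import Literature.AlgebraicGeometry.Motives.HodgeLieCenterIsomorphismInvariance
import HarnessLib

/-!
# Milne's `C(A)` with its involution `†`, `S(A)` and `G(A)` depend only on the isogeny class, "up to a unique
# isomorphism": transport along an isomorphism `e : e^* H ⥲ H` of polarized `ℚ`-Hodge structures, on `ℚ`- and `K`-points
# (Milne 1999 §1 p. 643 L5–L11, p. 644 L16–L21; §4 p. 659 L10–L13, Cor. 4.7)

[topic AlgebraicGeometry/Motives]

Layer `Literature/AlgebraicGeometry/Motives`, lane `lit-hodgefound` (Track 2 foundations library; seat `lit-hodgefound-p34`,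
generation 20, self-proposed row g20-#4 of `run/shared/lean/pub/lit-hodgefound/SKELETON.md`): the FUNCTORIALITY IN THE
ISOMORPHISM CLASS of the objects of the seat's g18-#1 `Motives/HodgeStructureLefschetzGroupPoints` — Milne's centraliser
`C(H) = Subalgebra.centralizer ℚ End_HS(H)` with `† = Polarization.adjoint`, `S(H)(ℚ) = Polarization.lefschetzGroup`,
`S(H)(K) = Polarization.lefschetzGroupBaseChange K`, `G(H)(K) = Polarization.lefschetzSimilitudeGroupBaseChange K` — along
the tree's transport of structure `HodgeStructure.comapEquiv H e = e^* H`, `Polarization.comapEquiv Q e = e^* Q = Q(e ·, e ·)`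
(`Motives/GeometricVHSPolarizedTransport`) for a `ℚ`-linear equivalence `e : V ⥲ W` (Milne's `V(α) : V(A) ⥲ V(B)` of an
isogeny `α : A → B`; `A`-side = `e^* H` on `V`, `B`-side = `H` on `W`). THEOREMS, and five ISOMORPHISMS WITH BODIES
(`endAlgComapEquivAlgEquiv`, `centralizerEndAlgComapEquivAlgEquiv`, `Polarization.lefschetzGroupComapEquivMulEquiv`,
`Polarization.lefschetzGroupBaseChangeComapEquivMulEquiv`, `Polarization.lefschetzSimilitudeGroupBaseChangeComapEquivMulEquiv`)
built from Mathlib's `LinearEquiv.conjAlgEquiv` / the tree's `glConjHom`; no named fact (net debt `0`).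

## The source, verbatim

J. S. Milne, *Lefschetz classes on abelian varieties*, Duke Math. J. **96** (1999) 639–675 [Milne1999LefschetzClasses]
(held `paper:doi-10-1215-s0012-7094-99-09620-5`; Duke page = folio + 638). §1 p. 643 (p0005) L5–L11: "Then `C(A)` is a
`k`-algebra stable under the involution `†` defined by an ample divisor `D`, and the restriction of `†` to `C(A)` is
independent of the choice of `D`. **An isogeny `α : A → B` defines an isomorphism `γ ↦ V(α) ∘ γ ∘ V(α)⁻¹ : C(A) → C(B)` of
`k`-algebras with involution, which is independent of the choice of `α`. Therefore `C(A)`, as a `k`-algebra with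
involution, depends only on the isogeny class of `A` (up to a canonical isomorphism).**" p. 644 (p0006) L16–L21: "The
group `S(A)`. […] `S(A)(R) = {γ ∈ C(A) ⊗_k R | γ†γ = 1}`. […] **Clearly `S(A)` depends only on the isogeny class of `A` (up
to a unique isomorphism).**" §4 p. 659 (p0021) L10–L13: "`G(A)(R) = {γ ∈ C(A) ⊗ R | γ†γ ∈ R^×}` […]", Thm. 4.4
(`G(A) ⥲ L(A)`, `γ ↦ (γ, γ†γ)`) and Cor. 4.7 ("An isogeny […] defines an isomorphism `(L(A), l(A)) → ∏ (L(Aᵢ), l(Aᵢ))`":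
the multiplier is carried along).

THE MECHANISM (as printed, "independent of the choice of `α`"): two isomorphisms `e, e′ : e^* H = e′^* H ⥲ H` differ by
`u = e′ e⁻¹ ∈ Aut_HS(H) ⊆ End_HS(H)^×` (`coe_symm_trans_mem_endAlg_of_comapEquiv_eq`), and conjugation by `u` (resp.
`u_K = 1 ⊗ u`) is the identity on everything that commutes with `End_HS(H)` (resp. with the `a_K`, `a ∈ End_HS(H)`) —
on `C(H)`, `S(H)(ℚ)`, `S(H)(K)`, `G(H)(K)` (`conjAlgEquiv_eq_self_of_mem_endAlg_of_mem_centralizer`,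
`symm_trans_trans_eq_self_of_mem_endAlg`, `baseChange_symm_trans_trans_eq_self_of_mem_endAlg`).

## What is PROVED (namespaces `Literature.AlgebraicGeometry.Motives` (§0), `….Motives.HodgeStructure` (§§1–3))

Conventions as in `Motives/MumfordTateGroupTransportPoints`: `E = 1 ⊗ e = e.baseChange ℚ K V W`; `E γ E⁻¹` is written
`E.symm.trans (γ.trans E)` (`y ↦ E (γ (E⁻¹ y))`), `E⁻¹ Γ E` is the tree's `glConjHom E Γ` (`Motives/TensorSpaceOfTensorSpaceOver`).
* §0 `bilinForm_baseChange_compl₁₂` (`(B(f·, g·))_K = B_K(f_K ·, g_K ·)`), `baseChange_symm_comp_comp_apply` /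
  `baseChange_comp_comp_symm_apply` (`(e⁻¹ a e)_K = E⁻¹ a_K E`, `(e a e⁻¹)_K = E a_K E⁻¹`).
* §1 (`ℚ`-algebras). `endAlg_comapEquiv_eq_comap`, `map_conjAlgEquiv_endAlg_comapEquiv` (`e End_HS(e^* H) e⁻¹ = End_HS(H)`,
  from the tree's `mem_endAlg_comapEquiv_iff` of `Motives/HodgeLieCenterIsomorphismInvariance`), DEF
  `endAlgComapEquivAlgEquiv : End_HS(e^* H) ≃ₐ[ℚ] End_HS(H)`; **`mem_centralizer_endAlg_comapEquiv_iff`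
  (`c ∈ C(e^* H) ↔ e c e⁻¹ ∈ C(H)`)**, `centralizer_endAlg_comapEquiv_eq_comap`, `map_conjAlgEquiv_centralizer_endAlg_comapEquiv`,
  **DEF `centralizerEndAlgComapEquivAlgEquiv : C(e^* H) ≃ₐ[ℚ] C(H)`, `c ↦ e c e⁻¹`** ("`γ ↦ V(α) ∘ γ ∘ V(α)⁻¹`");
  **"of `k`-algebras with involution": `Polarization.conjAlgEquiv_adjoint_comapEquiv` — `e a^{†′} e⁻¹ = (e a e⁻¹)^†`** for the
  adjoints `†′` of `e^* Q` and `†` of `Q` (all `a ∈ End_ℚ(V)`), `Polarization.adjoint_comapEquiv`,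
  `Polarization.coe_centralizerEndAlgComapEquivAlgEquiv_adjoint`; **"independent of the choice of `α`":
  `conjAlgEquiv_eq_of_comapEquiv_eq` — `e^* H = e′^* H` ⇒ `e′ c e′⁻¹ = e c e⁻¹` on `C(e^* H)`**,
  `coe_centralizerEndAlgComapEquivAlgEquiv_eq_of_comapEquiv_eq`.
* §2 (`ℚ`-points). **`Polarization.mem_lefschetzGroup_comapEquiv_iff` (`g ∈ S(e^* H)(ℚ) ↔ e g e⁻¹ ∈ S(H)(ℚ)`)**,
  `Polarization.lefschetzGroup_comapEquiv_eq_map` (`S(e^* H)(ℚ) = e⁻¹ S(H)(ℚ) e`), DEF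
  `Polarization.lefschetzGroupComapEquivMulEquiv : S(e^* H)(ℚ) ≃* S(H)(ℚ)`; uniqueness: `symm_trans_trans_eq_of_comapEquiv_eq`,
  `Polarization.lefschetzGroup_comapEquiv_eq_of_comapEquiv_eq` (the subgroup depends on `e^* H` only),
  `Polarization.coe_lefschetzGroupComapEquivMulEquiv_eq_of_comapEquiv_eq`.
* §3 (`K`-points, every field `K ⊇ ℚ`). **`Polarization.mem_lefschetzGroupBaseChange_comapEquiv_iff`
  (`γ ∈ S(e^* H)(K) ↔ E γ E⁻¹ ∈ S(H)(K)`)**, **`Polarization.mem_lefschetzSimilitudeGroupBaseChange_comapEquiv_iff` (the same for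
  `G`, multiplier for multiplier: `Polarization.forall_comapEquiv_form_baseChange_eq_mul_iff`)**, the `glConjHom` forms read
  from `H`, `…_comapEquiv_eq_map` (`S(e^* H)(K) = E⁻¹ S(H)(K) E`, `G(e^* H)(K) = E⁻¹ G(H)(K) E`), DEFS
  `Polarization.lefschetzGroupBaseChangeComapEquivMulEquiv : S(e^* H)(K) ≃* S(H)(K)` and
  `Polarization.lefschetzSimilitudeGroupBaseChangeComapEquivMulEquiv : G(e^* H)(K) ≃* G(H)(K)` (compatible with `S ≤ G`,
  `…_inclusion`, and with `ℚ`-points, `baseChange_symm_trans_trans`: `(e g e⁻¹)_K = E g_K E⁻¹`); uniqueness: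
  `baseChange_symm_trans_trans_eq_of_comapEquiv_eq`, `Polarization.lefschetzGroupBaseChange_comapEquiv_eq_of_comapEquiv_eq`,
  `Polarization.lefschetzSimilitudeGroupBaseChange_comapEquiv_eq_of_comapEquiv_eq`, `Polarization.coe_…_eq_of_comapEquiv_eq`.

TWINS ON OTHER CARRIERS, BY NAME ONLY (not imported): `Milne1999/LefschetzCentraliserIsogeny` proves the isogeny
invariance of `C(A) ⊗ ℂ`, `S(A)(ℂ)`, `G(A)(ℂ)` for complex ABELIAN VARIETIES read on `H¹(A(ℂ); ℂ)` (`ℂ`-points, pull-back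
`f^*` of a genuine isogeny, `autConj`); `Motives/MumfordTateGroupTransport` / `Motives/MumfordTateGroupTransportPoints` prove
`MT(e^* H)(L) = E⁻¹ MT(H)(L) E`, `Hg(e^* H)(L) = E⁻¹ Hg(H)(L) E` with the same conjugating element, so the inclusions
`Hg ≤ S`, `MT ≤ G` of g18-#1 (`hodgeGroupBaseChange_le_lefschetzGroupBaseChange`,
`mumfordTateGroupBaseChange_le_lefschetzSimilitudeGroupBaseChange`) are transported compatibly. The present file is the
abstract polarized-`ℚ`-Hodge-structure layer, on `ℚ`-points and on `K`-points for every `K`, with the involution `†` itself.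

NOT HERE: isogenies of abelian varieties and `V(α)` (the twin above); Prop. 1.1 / 1.5 (products of isogeny factors: the
direct-sum shapes are `Motives/HodgeStructureCentralizerDirectSum`, `Motives/HodgeStructureLefschetzGroupDirectSum{,Points}`,
BY NAME); the algebraic groups as schemes (the tree works point-wise, one subgroup of `GL(K ⊗ V)` per field `K`).

## References

* [Milne1999LefschetzClasses] J. S. Milne, *Lefschetz classes on abelian varieties*, Duke Math. J. 96 (1999) 639–675:
  §1 p. 643 L5–L11 (`C(A)` with `†` along an isogeny, independence of `α`), p. 644 L16–L21 (`S(A)`), §4 p. 659 L10–L13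
  (`G(A)`), Thm. 4.4, Cor. 4.7.
* [Deligne1982HodgeCycles] P. Deligne, *Hodge cycles on abelian varieties*, LNM 900 (1982), I §3.1 (extension of scalars
  of the groups attached to `(V, h)`; functoriality in `V`).
-/

noncomputable section

open scoped TensorProduct

universe uK u

namespace Literature.AlgebraicGeometry.Motives

/-! ### §0 Linear algebra over a field `K ⊇ ℚ`: base change of a transported form and of a conjugated map -/

section LinearAlgebra

variable (K : Type uK) [Field K] [Algebra ℚ K] {V W : Type u} [AddCommGroup V] [Module ℚ V] [AddCommGroup W]
  [Module ℚ W]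

/-- `(1 ⊗ e) x = e_K x`: the base change of a linear equivalence, applied, is the base change of its
underlying linear map (extension of scalars `V ↦ V ⊗ K`, functorial in `V`). [cite: Deligne1982HodgeCycles, I §3.1] -/
theorem equivBaseChange_apply (e : V ≃ₗ[ℚ] W) (x : K ⊗[ℚ] V) :
    e.baseChange ℚ K V W x = e.toLinearMap.baseChange K x := by
  rw [← LinearEquiv.coe_coe, LinearEquiv.coe_baseChange]

/-- `(1 ⊗ e)⁻¹ y = (e⁻¹)_K y`. [cite: Deligne1982HodgeCycles, I §3.1] -/
theorem equivBaseChange_symm_apply (e : V ≃ₗ[ℚ] W) (y : K ⊗[ℚ] W) :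
    (e.baseChange ℚ K V W).symm y = e.symm.toLinearMap.baseChange K y := by
  rw [← LinearEquiv.baseChange_symm, equivBaseChange_apply]

/-- **Base change of a transported bilinear form**: `(B(f ·, g ·))_K (x, y) = B_K (f_K x, g_K y)` (Milne's Remark 1.6:
the objects defined relative to `H ⊗_k k′` are the base changes, `C′(A) ≅ C(A) ⊗_k k′`, `S′(A) ≅ S(A)_{/k′}`).
[cite: Milne1999LefschetzClasses, §1 Remark 1.6 (p. 644)] [cite: Deligne1982HodgeCycles, I §3.1] -/
theorem bilinForm_baseChange_compl₁₂ (B : LinearMap.BilinForm ℚ W) (f g : V →ₗ[ℚ] W) (x y : K ⊗[ℚ] V) :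
    LinearMap.BilinForm.baseChange K (B.compl₁₂ f g) x y = B.baseChange K (f.baseChange K x) (g.baseChange K y) := by
  induction x using TensorProduct.induction_on with
  | zero => simp only [map_zero, LinearMap.zero_apply]
  | add x x' hx hx' => simp only [map_add, LinearMap.add_apply, hx, hx']
  | tmul c v =>
    induction y using TensorProduct.induction_on with
    | zero => simp only [map_zero]
    | add y y' hy hy' => simp only [map_add, hy, hy']
    | tmul d w =>
      simp only [LinearMap.baseChange_tmul, LinearMap.BilinForm.baseChange_tmul, LinearMap.compl₁₂_apply]

/-- `(B(e ·, e ·))_K (x, y) = B_K ((1 ⊗ e) x, (1 ⊗ e) y)` for a linear equivalence `e`.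
[cite: Milne1999LefschetzClasses, §1 Remark 1.6 (p. 644)] [cite: Deligne1982HodgeCycles, I §3.1] -/
theorem bilinForm_baseChange_compl₁₂_equiv (B : LinearMap.BilinForm ℚ W) (e : V ≃ₗ[ℚ] W) (x y : K ⊗[ℚ] V) :
    LinearMap.BilinForm.baseChange K (B.compl₁₂ e.toLinearMap e.toLinearMap) x y =
      B.baseChange K (e.baseChange ℚ K V W x) (e.baseChange ℚ K V W y) := by
  rw [bilinForm_baseChange_compl₁₂, equivBaseChange_apply, equivBaseChange_apply]

/-- **Base change of a conjugated endomorphism**: `(e⁻¹ ∘ a ∘ e)_K = (1 ⊗ e)⁻¹ ∘ a_K ∘ (1 ⊗ e)`, pointwise.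
[cite: Milne1999LefschetzClasses, §1 Remark 1.6 (p. 644)] [cite: Deligne1982HodgeCycles, I §3.1] -/
theorem baseChange_symm_comp_comp_apply (e : V ≃ₗ[ℚ] W) (a : Module.End ℚ W) (x : K ⊗[ℚ] V) :
    (e.symm.toLinearMap ∘ₗ a ∘ₗ e.toLinearMap).baseChange K x =
      (e.baseChange ℚ K V W).symm (a.baseChange K (e.baseChange ℚ K V W x)) := by
  rw [LinearMap.baseChange_comp, LinearMap.baseChange_comp, LinearMap.comp_apply, LinearMap.comp_apply,
    equivBaseChange_symm_apply, equivBaseChange_apply]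

/-- `(e ∘ a ∘ e⁻¹)_K = (1 ⊗ e) ∘ a_K ∘ (1 ⊗ e)⁻¹`, pointwise. [cite: Milne1999LefschetzClasses, §1 Remark 1.6 (p. 644)]
[cite: Deligne1982HodgeCycles, I §3.1] -/
theorem baseChange_comp_comp_symm_apply (e : V ≃ₗ[ℚ] W) (a : Module.End ℚ V) (y : K ⊗[ℚ] W) :
    (e.toLinearMap ∘ₗ a ∘ₗ e.symm.toLinearMap).baseChange K y =
      e.baseChange ℚ K V W (a.baseChange K ((e.baseChange ℚ K V W).symm y)) := by
  rw [LinearMap.baseChange_comp, LinearMap.baseChange_comp, LinearMap.comp_apply, LinearMap.comp_apply,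
    equivBaseChange_symm_apply, equivBaseChange_apply]

end LinearAlgebra

namespace HodgeStructure

/-! ### §1 The endomorphism algebra, the centraliser `C` and its involution `†` along `e : e^* H ⥲ H` -/

section Algebras

variable {V W : Type u} [AddCommGroup V] [Module ℚ V] [AddCommGroup W] [Module ℚ W] {n : ℤ}
  (H : HodgeStructure W n) (e : V ≃ₗ[ℚ] W)

/-- Read from `H`: `a ∈ End_HS(H) ↔ e⁻¹ a e ∈ End_HS(e^* H)`. [cite: Milne1999LefschetzClasses, §1 p. 643 L7–L11] -/
theorem mem_endAlg_iff_symm_comp_comp_mem_endAlg_comapEquiv (a : Module.End ℚ W) :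
    a ∈ H.endAlg ↔ e.symm.toLinearMap ∘ₗ a ∘ₗ e.toLinearMap ∈ (H.comapEquiv e).endAlg := by
  rw [mem_endAlg_comapEquiv_iff]
  have h : e.toLinearMap ∘ₗ (e.symm.toLinearMap ∘ₗ a ∘ₗ e.toLinearMap) ∘ₗ e.symm.toLinearMap = a :=
    LinearMap.ext fun w ↦ by
      simp only [LinearMap.coe_comp, LinearEquiv.coe_coe, Function.comp_apply, LinearEquiv.apply_symm_apply]
  rw [h]

/-- **`End_HS(e^* H) = (a ↦ e a e⁻¹)⁻¹ End_HS(H)`** as `ℚ`-subalgebras, the conjugation being Mathlib's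
`LinearEquiv.conjAlgEquiv`. [cite: Milne1999LefschetzClasses, §1 p. 643 L7–L11] -/
theorem endAlg_comapEquiv_eq_comap :
    (H.comapEquiv e).endAlg =
      H.endAlg.comap (e.conjAlgEquiv ℚ : Module.End ℚ V →ₐ[ℚ] Module.End ℚ W) :=
  Subalgebra.ext fun a ↦ (mem_endAlg_comapEquiv_iff H e a).trans
    (Subalgebra.mem_comap H.endAlg (e.conjAlgEquiv ℚ : Module.End ℚ V →ₐ[ℚ] Module.End ℚ W) a).symm

/-- **`e End_HS(e^* H) e⁻¹ = End_HS(H)`**. [cite: Milne1999LefschetzClasses, §1 p. 643 L7–L11] -/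
theorem map_conjAlgEquiv_endAlg_comapEquiv :
    ((H.comapEquiv e).endAlg).map (e.conjAlgEquiv ℚ : Module.End ℚ V →ₐ[ℚ] Module.End ℚ W) = H.endAlg := by
  ext a
  rw [Subalgebra.mem_map]
  constructor
  · rintro ⟨x, hx, rfl⟩
    exact (mem_endAlg_comapEquiv_iff H e x).1 hx
  · intro ha
    exact ⟨(e.conjAlgEquiv ℚ).symm a, (mem_endAlg_iff_symm_comp_comp_mem_endAlg_comapEquiv H e a).1 ha,
      (e.conjAlgEquiv ℚ).apply_symm_apply a⟩

/-- **The endomorphism algebras of isomorphic Hodge structures are isomorphic: `End_HS(e^* H) ≃ₐ End_HS(H)`,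
`a ↦ e a e⁻¹`** ("`End⁰(A) ≅ End⁰(B)` along an isogeny"). [cite: Milne1999LefschetzClasses, §1 p. 643 L7–L11] -/
def endAlgComapEquivAlgEquiv : (H.comapEquiv e).endAlg ≃ₐ[ℚ] H.endAlg :=
  ((e.conjAlgEquiv ℚ).subalgebraMap (H.comapEquiv e).endAlg).trans
    (Subalgebra.equivOfEq _ _ (map_conjAlgEquiv_endAlg_comapEquiv H e))

/-- `endAlgComapEquivAlgEquiv H e a = e ∘ a ∘ e⁻¹` on underlying endomorphisms.
[cite: Milne1999LefschetzClasses, §1 p. 643 L7–L11] -/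
@[simp]
theorem coe_endAlgComapEquivAlgEquiv (a : (H.comapEquiv e).endAlg) :
    ((endAlgComapEquivAlgEquiv H e a : H.endAlg) : Module.End ℚ W) =
      e.toLinearMap ∘ₗ (a : Module.End ℚ V) ∘ₗ e.symm.toLinearMap :=
  rfl

/-- **`c ∈ C(e^* H) ↔ e c e⁻¹ ∈ C(H)`** for Milne's centraliser `C = End_{E_φ}(V)` of the endomorphism algebra —
"An isogeny `α : A → B` defines an isomorphism `γ ↦ V(α) ∘ γ ∘ V(α)⁻¹ : C(A) → C(B)`".
[cite: Milne1999LefschetzClasses, §1 p. 643 L7–L8] -/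
theorem mem_centralizer_endAlg_comapEquiv_iff (c : Module.End ℚ V) :
    c ∈ Subalgebra.centralizer ℚ ((H.comapEquiv e).endAlg : Set (Module.End ℚ V)) ↔
      e.conjAlgEquiv ℚ c ∈ Subalgebra.centralizer ℚ (H.endAlg : Set (Module.End ℚ W)) := by
  rw [Subalgebra.mem_centralizer_iff, Subalgebra.mem_centralizer_iff]
  constructor
  · intro h a ha
    have ha' : (e.conjAlgEquiv ℚ).symm a ∈ (H.comapEquiv e).endAlg :=
      (mem_endAlg_iff_symm_comp_comp_mem_endAlg_comapEquiv H e a).1 ha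
    have h' := congrArg (e.conjAlgEquiv ℚ) (h _ ha')
    rwa [map_mul, map_mul, AlgEquiv.apply_symm_apply] at h'
  · intro h a ha
    refine (e.conjAlgEquiv ℚ).injective ?_
    rw [map_mul, map_mul]
    exact h _ ((mem_endAlg_comapEquiv_iff H e a).1 ha)

/-- **`C(e^* H) = (c ↦ e c e⁻¹)⁻¹ C(H)`** as `ℚ`-subalgebras. [cite: Milne1999LefschetzClasses, §1 p. 643 L7–L11] -/
theorem centralizer_endAlg_comapEquiv_eq_comap :
    Subalgebra.centralizer ℚ ((H.comapEquiv e).endAlg : Set (Module.End ℚ V)) =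
      (Subalgebra.centralizer ℚ (H.endAlg : Set (Module.End ℚ W))).comap
        (e.conjAlgEquiv ℚ : Module.End ℚ V →ₐ[ℚ] Module.End ℚ W) :=
  Subalgebra.ext fun c ↦ (mem_centralizer_endAlg_comapEquiv_iff H e c).trans
    (Subalgebra.mem_comap (Subalgebra.centralizer ℚ (H.endAlg : Set (Module.End ℚ W)))
      (e.conjAlgEquiv ℚ : Module.End ℚ V →ₐ[ℚ] Module.End ℚ W) c).symm

/-- **`e C(e^* H) e⁻¹ = C(H)`** (the conjugation is ONTO). [cite: Milne1999LefschetzClasses, §1 p. 643 L7–L11] -/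
theorem map_conjAlgEquiv_centralizer_endAlg_comapEquiv :
    (Subalgebra.centralizer ℚ ((H.comapEquiv e).endAlg : Set (Module.End ℚ V))).map
        (e.conjAlgEquiv ℚ : Module.End ℚ V →ₐ[ℚ] Module.End ℚ W) =
      Subalgebra.centralizer ℚ (H.endAlg : Set (Module.End ℚ W)) := by
  ext c
  rw [Subalgebra.mem_map]
  constructor
  · rintro ⟨x, hx, rfl⟩
    exact (mem_centralizer_endAlg_comapEquiv_iff H e x).1 hx
  · intro hc
    refine ⟨(e.conjAlgEquiv ℚ).symm c, ?_, (e.conjAlgEquiv ℚ).apply_symm_apply c⟩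
    rw [mem_centralizer_endAlg_comapEquiv_iff, AlgEquiv.apply_symm_apply]
    exact hc

/-- **Milne's isomorphism `γ ↦ V(α) ∘ γ ∘ V(α)⁻¹ : C(A) → C(B)` of `k`-algebras**, for `k = ℚ`, on the abstract
polarizable `ℚ`-Hodge structure: `C(e^* H) ≃ₐ[ℚ] C(H)`, `c ↦ e c e⁻¹` (compatible with the involutions:
`conjAlgEquiv_adjoint_comapEquiv`; independent of the isomorphism `e`: `conjAlgEquiv_eq_of_comapEquiv_eq`).
[cite: Milne1999LefschetzClasses, §1 p. 643 L7–L11] -/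
def centralizerEndAlgComapEquivAlgEquiv :
    Subalgebra.centralizer ℚ ((H.comapEquiv e).endAlg : Set (Module.End ℚ V)) ≃ₐ[ℚ]
      Subalgebra.centralizer ℚ (H.endAlg : Set (Module.End ℚ W)) :=
  ((e.conjAlgEquiv ℚ).subalgebraMap _).trans
    (Subalgebra.equivOfEq _ _ (map_conjAlgEquiv_centralizer_endAlg_comapEquiv H e))

/-- `centralizerEndAlgComapEquivAlgEquiv H e c = e ∘ c ∘ e⁻¹` on underlying endomorphisms.
[cite: Milne1999LefschetzClasses, §1 p. 643 L7–L8] -/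
@[simp]
theorem coe_centralizerEndAlgComapEquivAlgEquiv
    (c : Subalgebra.centralizer ℚ ((H.comapEquiv e).endAlg : Set (Module.End ℚ V))) :
    ((centralizerEndAlgComapEquivAlgEquiv H e c : Subalgebra.centralizer ℚ (H.endAlg : Set (Module.End ℚ W))) :
        Module.End ℚ W) = e.toLinearMap ∘ₗ (c : Module.End ℚ V) ∘ₗ e.symm.toLinearMap :=
  rfl

/-- `(centralizerEndAlgComapEquivAlgEquiv H e c) w = e (c (e⁻¹ w))`. [cite: Milne1999LefschetzClasses, §1 p. 643 L7–L8] -/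
theorem centralizerEndAlgComapEquivAlgEquiv_apply_apply
    (c : Subalgebra.centralizer ℚ ((H.comapEquiv e).endAlg : Set (Module.End ℚ V))) (w : W) :
    ((centralizerEndAlgComapEquivAlgEquiv H e c : Subalgebra.centralizer ℚ (H.endAlg : Set (Module.End ℚ W))) :
        Module.End ℚ W) w = e ((c : Module.End ℚ V) (e.symm w)) :=
  rfl

/-! #### "of `k`-algebras with involution": the adjoint `†` is transported -/

variable {H} [Module.Finite ℚ V] [Module.Finite ℚ W]

/-- **"of `k`-algebras with involution"**: for every `a ∈ End_ℚ(V)`, `e (a^{†'}) e⁻¹ = (e a e⁻¹)^†`, where `†'` is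
the adjoint for the transported polarization `e^* Q = Q(e ·, e ·)` and `†` the adjoint for `Q`.
[cite: Milne1999LefschetzClasses, §1 p. 643 L7–L9] -/
theorem Polarization.conjAlgEquiv_adjoint_comapEquiv (Q : Polarization H) (a : Module.End ℚ V) :
    e.conjAlgEquiv ℚ ((Q.comapEquiv e).adjoint a) = Q.adjoint (e.conjAlgEquiv ℚ a) := by
  refine Q.eq_adjoint_of_isAdjointPair fun x y ↦ ?_
  have h := (Q.comapEquiv e).form_apply_adjoint a (e.symm x) (e.symm y)
  rw [Polarization.comapEquiv_form_apply, Polarization.comapEquiv_form_apply, LinearEquiv.apply_symm_apply,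
    LinearEquiv.apply_symm_apply] at h
  simp only [LinearEquiv.conjAlgEquiv_apply, LinearMap.coe_comp, LinearEquiv.coe_coe, Function.comp_apply]
  exact h.symm

/-- The transported adjoint, explicitly: `a^{†'} = e⁻¹ (e a e⁻¹)^† e`. [cite: Milne1999LefschetzClasses, §1 p. 643 L7–L9] -/
theorem Polarization.adjoint_comapEquiv (Q : Polarization H) (a : Module.End ℚ V) :
    (Q.comapEquiv e).adjoint a =
      e.symm.toLinearMap ∘ₗ Q.adjoint (e.toLinearMap ∘ₗ a ∘ₗ e.symm.toLinearMap) ∘ₗ e.toLinearMap := by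
  have h := congrArg (e.conjAlgEquiv ℚ).symm (Q.conjAlgEquiv_adjoint_comapEquiv e a)
  rw [AlgEquiv.symm_apply_apply] at h
  exact h

/-- On the centraliser: `centralizerEndAlgComapEquivAlgEquiv` intertwines `†'` on `C(e^* H)` with `†` on `C(H)`
(both are `†`-stable, `Polarization.adjoint_mem_centralizer_endAlg`). [cite: Milne1999LefschetzClasses, §1 p. 643 L5–L9] -/
theorem Polarization.coe_centralizerEndAlgComapEquivAlgEquiv_adjoint (Q : Polarization H)
    (c : Subalgebra.centralizer ℚ ((H.comapEquiv e).endAlg : Set (Module.End ℚ V))) :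
    ((centralizerEndAlgComapEquivAlgEquiv H e
        ⟨(Q.comapEquiv e).adjoint c, (Q.comapEquiv e).adjoint_mem_centralizer_endAlg c.2⟩ :
          Subalgebra.centralizer ℚ (H.endAlg : Set (Module.End ℚ W))) : Module.End ℚ W) =
      Q.adjoint ((centralizerEndAlgComapEquivAlgEquiv H e c : Subalgebra.centralizer ℚ (H.endAlg : Set (Module.End ℚ W))) :
        Module.End ℚ W) :=
  Q.conjAlgEquiv_adjoint_comapEquiv e (c : Module.End ℚ V)

/-! #### "independent of the choice of `α`" -/

variable (H)

omit [Module.Finite ℚ V] [Module.Finite ℚ W] in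
/-- An AUTOMORPHISM `u` of the Hodge structure `H` (`↑u ∈ End_HS(H)`) conjugates every element of the centraliser
`C(H)` to itself: `u c u⁻¹ = c`. [cite: Milne1999LefschetzClasses, §1 p. 643 L7–L9] -/
theorem conjAlgEquiv_eq_self_of_mem_endAlg_of_mem_centralizer (u : W ≃ₗ[ℚ] W)
    (hu : (u : Module.End ℚ W) ∈ H.endAlg) {c : Module.End ℚ W}
    (hc : c ∈ Subalgebra.centralizer ℚ (H.endAlg : Set (Module.End ℚ W))) : u.conjAlgEquiv ℚ c = c := by
  rw [Subalgebra.mem_centralizer_iff] at hc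
  refine LinearMap.ext fun w ↦ ?_
  have h := LinearMap.congr_fun (hc _ hu) (u.symm w)
  rw [Module.End.mul_apply, Module.End.mul_apply, LinearEquiv.coe_coe, LinearEquiv.apply_symm_apply] at h
  rw [LinearEquiv.conjAlgEquiv_apply, LinearMap.comp_apply, LinearMap.comp_apply, LinearEquiv.coe_coe,
    LinearEquiv.coe_coe]
  exact h

omit [Module.Finite ℚ V] [Module.Finite ℚ W] in
/-- **"independent of the choice of `α`"**, first form: composing the isomorphism `e : e^* H ⥲ H` with an
automorphism `u` of `H` does not change the induced map on `C(e^* H)`: `(u e) c (u e)⁻¹ = e c e⁻¹` for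
`c ∈ C(e^* H)`. [cite: Milne1999LefschetzClasses, §1 p. 643 L7–L9] -/
theorem conjAlgEquiv_trans_eq_of_mem_centralizer_endAlg_comapEquiv (u : W ≃ₗ[ℚ] W)
    (hu : (u : Module.End ℚ W) ∈ H.endAlg) {c : Module.End ℚ V}
    (hc : c ∈ Subalgebra.centralizer ℚ ((H.comapEquiv e).endAlg : Set (Module.End ℚ V))) :
    (e.trans u).conjAlgEquiv ℚ c = e.conjAlgEquiv ℚ c := by
  have h1 : (e.trans u).conjAlgEquiv ℚ c = u.conjAlgEquiv ℚ (e.conjAlgEquiv ℚ c) := LinearMap.ext fun _ ↦ rfl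
  rw [h1]
  exact conjAlgEquiv_eq_self_of_mem_endAlg_of_mem_centralizer H u hu
    ((mem_centralizer_endAlg_comapEquiv_iff H e c).1 hc)

omit [Module.Finite ℚ V] [Module.Finite ℚ W] in
/-- Two linear equivalences `e, e' : V ⥲ W` inducing THE SAME Hodge structure `e^* H = e'^* H` on `V` differ by an
automorphism of `H`: `e' e⁻¹ ∈ End_HS(H)` (Milne: "`V(α') ∘ V(α)⁻¹ ∈ End⁰(B)`").
[cite: Milne1999LefschetzClasses, §1 p. 643 L7–L9] -/
theorem coe_symm_trans_mem_endAlg_of_comapEquiv_eq {e e' : V ≃ₗ[ℚ] W} (h : H.comapEquiv e = H.comapEquiv e') :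
    ((e.symm.trans e' : W ≃ₗ[ℚ] W) : Module.End ℚ W) ∈ H.endAlg := by
  have h0 : ∀ p, (H.F p).comap (e.toLinearMap.baseChange ℂ) = (H.comapEquiv e).F p := fun _ ↦ rfl
  have h' : ∀ p, (H.F p).comap (e'.toLinearMap.baseChange ℂ) = (H.comapEquiv e).F p := fun p ↦ by
    rw [h]; rfl
  exact Hom.toLinearMap_mem_endAlg ((Hom.ofComapBaseChange e' h').comp (Hom.symmOfComapBaseChange e h0))

omit [Module.Finite ℚ V] [Module.Finite ℚ W] in
/-- **"independent of the choice of `α`"** (Milne p. 643 L9): two isomorphisms `e, e' : e^* H = e'^* H ⥲ H` of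
Hodge structures induce the same map `C(e^* H) → C(H)`: `e' c e'⁻¹ = e c e⁻¹` for every `c ∈ C(e^* H)`.
[cite: Milne1999LefschetzClasses, §1 p. 643 L7–L11] -/
theorem conjAlgEquiv_eq_of_comapEquiv_eq {e e' : V ≃ₗ[ℚ] W} (h : H.comapEquiv e = H.comapEquiv e')
    {c : Module.End ℚ V} (hc : c ∈ Subalgebra.centralizer ℚ ((H.comapEquiv e).endAlg : Set (Module.End ℚ V))) :
    e'.conjAlgEquiv ℚ c = e.conjAlgEquiv ℚ c := by
  have he : e' = e.trans (e.symm.trans e') :=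
    LinearEquiv.ext fun v ↦ by simp only [LinearEquiv.trans_apply, LinearEquiv.symm_apply_apply]
  rw [he]
  exact conjAlgEquiv_trans_eq_of_mem_centralizer_endAlg_comapEquiv H e _
    (coe_symm_trans_mem_endAlg_of_comapEquiv_eq H h) hc

omit [Module.Finite ℚ V] [Module.Finite ℚ W] in
/-- The packaged form: the algebra isomorphisms `centralizerEndAlgComapEquivAlgEquiv H e` and `… H e'` agree on
underlying endomorphisms whenever `e^* H = e'^* H` ("up to a canonical isomorphism").
[cite: Milne1999LefschetzClasses, §1 p. 643 L9–L11] -/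
theorem coe_centralizerEndAlgComapEquivAlgEquiv_eq_of_comapEquiv_eq {e e' : V ≃ₗ[ℚ] W}
    (h : H.comapEquiv e = H.comapEquiv e')
    (c : Subalgebra.centralizer ℚ ((H.comapEquiv e).endAlg : Set (Module.End ℚ V))) :
    ((centralizerEndAlgComapEquivAlgEquiv H e' ⟨c, h ▸ c.2⟩ : Subalgebra.centralizer ℚ (H.endAlg : Set (Module.End ℚ W))) :
        Module.End ℚ W) =
      ((centralizerEndAlgComapEquivAlgEquiv H e c : Subalgebra.centralizer ℚ (H.endAlg : Set (Module.End ℚ W))) :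
        Module.End ℚ W) :=
  conjAlgEquiv_eq_of_comapEquiv_eq H h c.2

end Algebras

/-! ### §2 The group `S` on `ℚ`-points along `e : e^* H ⥲ H` -/

section RationalPoints

variable {V W : Type u} [AddCommGroup V] [Module ℚ V] [AddCommGroup W] [Module ℚ W] {n : ℤ}
  {H : HodgeStructure W n} (Q : Polarization H) (e : V ≃ₗ[ℚ] W)

/-- The commuting condition transported: `g` commutes with `End_HS(e^* H)` iff `e g e⁻¹` commutes with
`End_HS(H)`. [cite: Milne1999LefschetzClasses, §1 p. 644 L19–L21] -/
theorem forall_endAlg_comapEquiv_apply_iff (g : V ≃ₗ[ℚ] V) :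
    (∀ a : (H.comapEquiv e).endAlg, ∀ v, (a : Module.End ℚ V) (g v) = g ((a : Module.End ℚ V) v)) ↔
      ∀ a : H.endAlg, ∀ w, (a : Module.End ℚ W) (e.symm.trans (g.trans e) w) =
        e.symm.trans (g.trans e) ((a : Module.End ℚ W) w) := by
  constructor
  · intro h a w
    have ha := (mem_endAlg_iff_symm_comp_comp_mem_endAlg_comapEquiv H e (a : Module.End ℚ W)).1 a.2
    have h' := h ⟨_, ha⟩ (e.symm w)
    simp only [LinearMap.coe_comp, LinearEquiv.coe_coe, Function.comp_apply, LinearEquiv.apply_symm_apply] at h'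
    simp only [LinearEquiv.trans_apply]
    rw [← h', LinearEquiv.apply_symm_apply]
  · intro h a v
    have ha := (mem_endAlg_comapEquiv_iff H e (a : Module.End ℚ V)).1 a.2
    have h' := h ⟨_, ha⟩ (e v)
    simp only [LinearEquiv.trans_apply, LinearMap.coe_comp, LinearEquiv.coe_coe, Function.comp_apply,
      LinearEquiv.symm_apply_apply] at h'
    exact e.injective h'

/-- The isometry condition transported: `g` preserves `e^* Q = Q(e ·, e ·)` iff `e g e⁻¹` preserves `Q`.
[cite: Milne1999LefschetzClasses, §1 p. 644 L19–L21] -/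
theorem Polarization.forall_comapEquiv_form_apply_iff (g : V ≃ₗ[ℚ] V) :
    (∀ v w, (Q.comapEquiv e).form (g v) (g w) = (Q.comapEquiv e).form v w) ↔
      ∀ x y, Q.form (e.symm.trans (g.trans e) x) (e.symm.trans (g.trans e) y) = Q.form x y := by
  simp only [Polarization.comapEquiv_form_apply, LinearEquiv.trans_apply]
  constructor
  · intro h x y
    rw [h, LinearEquiv.apply_symm_apply, LinearEquiv.apply_symm_apply]
  · intro h v w
    have h' := h (e v) (e w)
    rwa [LinearEquiv.symm_apply_apply, LinearEquiv.symm_apply_apply] at h'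

/-- **`S` depends only on the isomorphism class, on `ℚ`-points: `g ∈ S(e^* H)(ℚ) ↔ e g e⁻¹ ∈ S(H)(ℚ)`** —
"Clearly `S(A)` depends only on the isogeny class of `A`". [cite: Milne1999LefschetzClasses, §1 p. 644 L19–L21] -/
theorem Polarization.mem_lefschetzGroup_comapEquiv_iff (g : V ≃ₗ[ℚ] V) :
    g ∈ (Q.comapEquiv e).lefschetzGroup ↔ e.symm.trans (g.trans e) ∈ Q.lefschetzGroup := by
  rw [Polarization.mem_lefschetzGroup_iff, Polarization.mem_lefschetzGroup_iff, forall_endAlg_comapEquiv_apply_iff,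
    Q.forall_comapEquiv_form_apply_iff e]

/-- Read from `H`: `g' ∈ S(H)(ℚ) ↔ e⁻¹ g' e ∈ S(e^* H)(ℚ)`, the conjugate written with the tree's `glConjHom e`
(`glConjHom e g' = e⁻¹ ∘ g' ∘ e`). [cite: Milne1999LefschetzClasses, §1 p. 644 L19–L21] -/
theorem Polarization.glConjHom_mem_lefschetzGroup_comapEquiv_iff (g' : W ≃ₗ[ℚ] W) :
    glConjHom e g' ∈ (Q.comapEquiv e).lefschetzGroup ↔ g' ∈ Q.lefschetzGroup := by
  rw [Q.mem_lefschetzGroup_comapEquiv_iff e]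
  have h : e.symm.trans ((glConjHom e g').trans e) = g' :=
    LinearEquiv.ext fun w ↦ by
      simp only [LinearEquiv.trans_apply, glConjHom_apply, LinearEquiv.apply_symm_apply]
  rw [h]

/-- **`S(e^* H)(ℚ) = e⁻¹ S(H)(ℚ) e`** as subgroups of `GL(V)`. [cite: Milne1999LefschetzClasses, §1 p. 644 L19–L21] -/
theorem Polarization.lefschetzGroup_comapEquiv_eq_map :
    (Q.comapEquiv e).lefschetzGroup = Q.lefschetzGroup.map (glConjHom e) := by
  ext g
  rw [Subgroup.mem_map]
  constructor
  · intro hg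
    refine ⟨e.symm.trans (g.trans e), (Q.mem_lefschetzGroup_comapEquiv_iff e g).1 hg, LinearEquiv.ext fun v ↦ ?_⟩
    simp only [glConjHom_apply, LinearEquiv.trans_apply, LinearEquiv.symm_apply_apply]
  · rintro ⟨g', hg', rfl⟩
    exact (Q.glConjHom_mem_lefschetzGroup_comapEquiv_iff e g').2 hg'

/-- **The isomorphism `S(e^* H)(ℚ) ≃ S(H)(ℚ)`, `g ↦ e g e⁻¹`** (inverse `g' ↦ e⁻¹ g' e`) — "`S(A)` depends only on the
isogeny class of `A` (up to a unique isomorphism)", on `ℚ`-points. [cite: Milne1999LefschetzClasses, §1 p. 644 L19–L21] -/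
def Polarization.lefschetzGroupComapEquivMulEquiv : (Q.comapEquiv e).lefschetzGroup ≃* Q.lefschetzGroup where
  toFun g := ⟨e.symm.trans (g.1.trans e), (Q.mem_lefschetzGroup_comapEquiv_iff e g.1).1 g.2⟩
  invFun g' := ⟨glConjHom e g'.1, (Q.glConjHom_mem_lefschetzGroup_comapEquiv_iff e g'.1).2 g'.2⟩
  left_inv g := Subtype.ext <| LinearEquiv.ext fun v ↦ by
    simp only [glConjHom_apply, LinearEquiv.trans_apply, LinearEquiv.symm_apply_apply]
  right_inv g' := Subtype.ext <| LinearEquiv.ext fun w ↦ by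
    simp only [LinearEquiv.trans_apply, glConjHom_apply, LinearEquiv.apply_symm_apply]
  map_mul' g g' := Subtype.ext <| LinearEquiv.ext fun w ↦ by
    simp only [Subgroup.coe_mul, LinearEquiv.trans_apply, LinearEquiv.mul_apply, LinearEquiv.symm_apply_apply]

/-- `lefschetzGroupComapEquivMulEquiv Q e g` acts by `w ↦ e (g (e⁻¹ w))`. [cite: Milne1999LefschetzClasses, §1 p. 644 L19–L21] -/
@[simp]
theorem Polarization.coe_lefschetzGroupComapEquivMulEquiv_apply (g : (Q.comapEquiv e).lefschetzGroup) (w : W) :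
    ((Q.lefschetzGroupComapEquivMulEquiv e g : Q.lefschetzGroup) : W ≃ₗ[ℚ] W) w = e (g.1 (e.symm w)) :=
  rfl

/-! #### "up to a unique isomorphism", on `ℚ`-points -/

/-- An automorphism `u` of `H` (`↑u ∈ End_HS(H)`) conjugates to itself every `g' ∈ GL(W)` commuting with `End_HS(H)`
(in particular every element of `S(H)(ℚ)`): `u g' u⁻¹ = g'`. [cite: Milne1999LefschetzClasses, §1 p. 644 L19–L21] -/
theorem symm_trans_trans_eq_self_of_mem_endAlg (u : W ≃ₗ[ℚ] W) (hu : (u : Module.End ℚ W) ∈ H.endAlg)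
    {g' : W ≃ₗ[ℚ] W} (hg' : ∀ a : H.endAlg, ∀ w, (a : Module.End ℚ W) (g' w) = g' ((a : Module.End ℚ W) w)) :
    u.symm.trans (g'.trans u) = g' := by
  refine LinearEquiv.ext fun w ↦ ?_
  have h := hg' ⟨_, hu⟩ (u.symm w)
  rw [LinearEquiv.coe_coe, LinearEquiv.apply_symm_apply] at h
  rw [LinearEquiv.trans_apply, LinearEquiv.trans_apply]
  exact h

/-- **"up to a unique isomorphism"**, on `ℚ`-points: two isomorphisms `e, e' : e^* H = e'^* H ⥲ H` of Hodge structures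
induce THE SAME map on every `g ∈ GL(V)` commuting with `End_HS(e^* H)` (in particular on `S(e^* H)(ℚ)`):
`e' g e'⁻¹ = e g e⁻¹`. [cite: Milne1999LefschetzClasses, §1 p. 644 L19–L21] -/
theorem symm_trans_trans_eq_of_comapEquiv_eq {e e' : V ≃ₗ[ℚ] W} (h : H.comapEquiv e = H.comapEquiv e')
    {g : V ≃ₗ[ℚ] V}
    (hg : ∀ a : (H.comapEquiv e).endAlg, ∀ v, (a : Module.End ℚ V) (g v) = g ((a : Module.End ℚ V) v)) :
    e'.symm.trans (g.trans e') = e.symm.trans (g.trans e) := by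
  have he : e' = e.trans (e.symm.trans e') :=
    LinearEquiv.ext fun v ↦ by simp only [LinearEquiv.trans_apply, LinearEquiv.symm_apply_apply]
  have h1 : (e.trans (e.symm.trans e')).symm.trans (g.trans (e.trans (e.symm.trans e'))) =
      (e.symm.trans e').symm.trans ((e.symm.trans (g.trans e)).trans (e.symm.trans e')) :=
    LinearEquiv.ext fun w ↦ by simp only [LinearEquiv.trans_apply, LinearEquiv.symm_trans_apply]
  rw [he, h1]
  exact symm_trans_trans_eq_self_of_mem_endAlg (e.symm.trans e') (coe_symm_trans_mem_endAlg_of_comapEquiv_eq H h)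
    ((forall_endAlg_comapEquiv_apply_iff e g).1 hg)

/-- The subgroup `S(e^* H)(ℚ) ≤ GL(V)` itself depends only on the Hodge structure `e^* H` (not on `e`, nor on the
polarization): `e^* H = e'^* H` ⇒ `S_{e^* Q}(ℚ) = S_{e'^* Q}(ℚ)`. [cite: Milne1999LefschetzClasses, §1 p. 644 L19–L21] -/
theorem Polarization.lefschetzGroup_comapEquiv_eq_of_comapEquiv_eq {e e' : V ≃ₗ[ℚ] W}
    (h : H.comapEquiv e = H.comapEquiv e') : (Q.comapEquiv e).lefschetzGroup = (Q.comapEquiv e').lefschetzGroup := by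
  ext g
  rw [Q.mem_lefschetzGroup_comapEquiv_iff e, Q.mem_lefschetzGroup_comapEquiv_iff e']
  constructor
  · intro hg
    have hc := ((forall_endAlg_comapEquiv_apply_iff e g).2 hg.1)
    rwa [symm_trans_trans_eq_of_comapEquiv_eq h hc]
  · intro hg
    have hc := ((forall_endAlg_comapEquiv_apply_iff e' g).2 hg.1)
    rwa [symm_trans_trans_eq_of_comapEquiv_eq h.symm hc]

/-- The packaged form on `ℚ`-points: the isomorphisms `lefschetzGroupComapEquivMulEquiv Q e` and `… Q e'` agree on
underlying automorphisms whenever `e^* H = e'^* H`. [cite: Milne1999LefschetzClasses, §1 p. 644 L19–L21] -/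
theorem Polarization.coe_lefschetzGroupComapEquivMulEquiv_eq_of_comapEquiv_eq {e e' : V ≃ₗ[ℚ] W}
    (h : H.comapEquiv e = H.comapEquiv e') (g : (Q.comapEquiv e).lefschetzGroup) :
    ((Q.lefschetzGroupComapEquivMulEquiv e'
        ⟨g, (Q.lefschetzGroup_comapEquiv_eq_of_comapEquiv_eq h).le g.2⟩ : Q.lefschetzGroup) : W ≃ₗ[ℚ] W) =
      ((Q.lefschetzGroupComapEquivMulEquiv e g : Q.lefschetzGroup) : W ≃ₗ[ℚ] W) :=
  symm_trans_trans_eq_of_comapEquiv_eq h g.2.1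

end RationalPoints

/-! ### §3 The groups `S` and `G` on `K`-points along `e : e^* H ⥲ H`, for every field `K ⊇ ℚ` -/

section Points

variable (K : Type uK) [Field K] [Algebra ℚ K] {V W : Type u} [AddCommGroup V] [Module ℚ V] [AddCommGroup W]
  [Module ℚ W] {n : ℤ} {H : HodgeStructure W n} (Q : Polarization H) (e : V ≃ₗ[ℚ] W)

/-- The commuting condition on `K`-points transported: `γ ∈ GL(K ⊗ V)` commutes with every `a_K`,
`a ∈ End_HS(e^* H)`, iff `(1⊗e) γ (1⊗e)⁻¹` commutes with every `a_K`, `a ∈ End_HS(H)`.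
[cite: Milne1999LefschetzClasses, §1 p. 644 L19–L21] -/
theorem forall_endAlg_comapEquiv_baseChange_apply_iff (γ : (K ⊗[ℚ] V) ≃ₗ[K] (K ⊗[ℚ] V)) :
    (∀ a : (H.comapEquiv e).endAlg, ∀ x,
        (a : Module.End ℚ V).baseChange K (γ x) = γ ((a : Module.End ℚ V).baseChange K x)) ↔
      ∀ a : H.endAlg, ∀ y,
        (a : Module.End ℚ W).baseChange K ((e.baseChange ℚ K V W).symm.trans (γ.trans (e.baseChange ℚ K V W)) y) =
          (e.baseChange ℚ K V W).symm.trans (γ.trans (e.baseChange ℚ K V W)) ((a : Module.End ℚ W).baseChange K y) := by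
  constructor
  · intro h a y
    have ha := (mem_endAlg_iff_symm_comp_comp_mem_endAlg_comapEquiv H e (a : Module.End ℚ W)).1 a.2
    have h' := h ⟨_, ha⟩ ((e.baseChange ℚ K V W).symm y)
    rw [baseChange_symm_comp_comp_apply, baseChange_symm_comp_comp_apply, LinearEquiv.apply_symm_apply] at h'
    have h'' := congrArg (e.baseChange ℚ K V W) h'
    rw [LinearEquiv.apply_symm_apply] at h''
    simp only [LinearEquiv.trans_apply]
    exact h''
  · intro h a x
    have ha := (mem_endAlg_comapEquiv_iff H e (a : Module.End ℚ V)).1 a.2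
    have h' := h ⟨_, ha⟩ (e.baseChange ℚ K V W x)
    rw [baseChange_comp_comp_symm_apply, baseChange_comp_comp_symm_apply] at h'
    simp only [LinearEquiv.trans_apply, LinearEquiv.symm_apply_apply] at h'
    exact (e.baseChange ℚ K V W).injective h'

/-- The transported polarization on `K`-points: `(e^* Q)_K (x, y) = Q_K ((1⊗e) x, (1⊗e) y)`.
[cite: Milne1999LefschetzClasses, §1 p. 644 L19–L21] -/
theorem Polarization.comapEquiv_form_baseChange_apply (x y : K ⊗[ℚ] V) :
    (Q.comapEquiv e).form.baseChange K x y =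
      Q.form.baseChange K (e.baseChange ℚ K V W x) (e.baseChange ℚ K V W y) :=
  bilinForm_baseChange_compl₁₂_equiv K Q.form e x y

/-- The similitude condition on `K`-points transported, multiplier for multiplier: `γ` multiplies `(e^* Q)_K` by
`ν` iff `(1⊗e) γ (1⊗e)⁻¹` multiplies `Q_K` by `ν`. [cite: Milne1999LefschetzClasses, §4 p. 659 L10–L13] -/
theorem Polarization.forall_comapEquiv_form_baseChange_eq_mul_iff (γ : (K ⊗[ℚ] V) ≃ₗ[K] (K ⊗[ℚ] V)) (ν : K) :
    (∀ x y, (Q.comapEquiv e).form.baseChange K (γ x) (γ y) = ν * (Q.comapEquiv e).form.baseChange K x y) ↔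
      ∀ x y, Q.form.baseChange K ((e.baseChange ℚ K V W).symm.trans (γ.trans (e.baseChange ℚ K V W)) x)
          ((e.baseChange ℚ K V W).symm.trans (γ.trans (e.baseChange ℚ K V W)) y) = ν * Q.form.baseChange K x y := by
  simp only [Polarization.comapEquiv_form_baseChange_apply, LinearEquiv.trans_apply]
  constructor
  · intro h x y
    rw [h, LinearEquiv.apply_symm_apply, LinearEquiv.apply_symm_apply]
  · intro h x y
    have h' := h (e.baseChange ℚ K V W x) (e.baseChange ℚ K V W y)
    rwa [LinearEquiv.symm_apply_apply, LinearEquiv.symm_apply_apply] at h'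

/-- **`S` depends only on the isomorphism class, on `K`-points: `γ ∈ S(e^* H)(K) ↔ (1⊗e) γ (1⊗e)⁻¹ ∈ S(H)(K)`**,
for every field `K ⊇ ℚ` — "Clearly `S(A)` depends only on the isogeny class of `A` (up to a unique isomorphism)"
for the algebraic group `S`, read on points. [cite: Milne1999LefschetzClasses, §1 p. 644 L16–L21] -/
theorem Polarization.mem_lefschetzGroupBaseChange_comapEquiv_iff (γ : (K ⊗[ℚ] V) ≃ₗ[K] (K ⊗[ℚ] V)) :
    γ ∈ (Q.comapEquiv e).lefschetzGroupBaseChange K ↔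
      (e.baseChange ℚ K V W).symm.trans (γ.trans (e.baseChange ℚ K V W)) ∈ Q.lefschetzGroupBaseChange K := by
  rw [Polarization.mem_lefschetzGroupBaseChange_iff, Polarization.mem_lefschetzGroupBaseChange_iff,
    forall_endAlg_comapEquiv_baseChange_apply_iff]
  have h := Q.forall_comapEquiv_form_baseChange_eq_mul_iff K e γ 1
  simp only [one_mul] at h
  rw [h]

/-- **`G` depends only on the isomorphism class, on `K`-points: `γ ∈ G(e^* H)(K) ↔ (1⊗e) γ (1⊗e)⁻¹ ∈ G(H)(K)`**
(with the same multiplier). [cite: Milne1999LefschetzClasses, §4 p. 659 L10–L13 and Cor. 4.7] -/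
theorem Polarization.mem_lefschetzSimilitudeGroupBaseChange_comapEquiv_iff (γ : (K ⊗[ℚ] V) ≃ₗ[K] (K ⊗[ℚ] V)) :
    γ ∈ (Q.comapEquiv e).lefschetzSimilitudeGroupBaseChange K ↔
      (e.baseChange ℚ K V W).symm.trans (γ.trans (e.baseChange ℚ K V W)) ∈
        Q.lefschetzSimilitudeGroupBaseChange K := by
  rw [Polarization.mem_lefschetzSimilitudeGroupBaseChange_iff, Polarization.mem_lefschetzSimilitudeGroupBaseChange_iff,
    forall_endAlg_comapEquiv_baseChange_apply_iff]
  exact and_congr Iff.rfl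
    (exists_congr fun ν ↦ and_congr Iff.rfl (Q.forall_comapEquiv_form_baseChange_eq_mul_iff K e γ ν))

/-- Read from `H`, with the tree's `glConjHom` (`glConjHom E Γ = E⁻¹ ∘ Γ ∘ E`): `(1⊗e)⁻¹ Γ (1⊗e) ∈ S(e^* H)(K) ↔
Γ ∈ S(H)(K)`. [cite: Milne1999LefschetzClasses, §1 p. 644 L16–L21] -/
theorem Polarization.glConjHom_mem_lefschetzGroupBaseChange_comapEquiv_iff (Γ : (K ⊗[ℚ] W) ≃ₗ[K] (K ⊗[ℚ] W)) :
    glConjHom (e.baseChange ℚ K V W) Γ ∈ (Q.comapEquiv e).lefschetzGroupBaseChange K ↔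
      Γ ∈ Q.lefschetzGroupBaseChange K := by
  rw [Q.mem_lefschetzGroupBaseChange_comapEquiv_iff K e]
  have h : (e.baseChange ℚ K V W).symm.trans ((glConjHom (e.baseChange ℚ K V W) Γ).trans (e.baseChange ℚ K V W)) = Γ :=
    LinearEquiv.ext fun y ↦ by
      simp only [LinearEquiv.trans_apply, glConjHom_apply, LinearEquiv.apply_symm_apply]
  rw [h]

/-- Read from `H`: `(1⊗e)⁻¹ Γ (1⊗e) ∈ G(e^* H)(K) ↔ Γ ∈ G(H)(K)`. [cite: Milne1999LefschetzClasses, §4 p. 659 L10–L13] -/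
theorem Polarization.glConjHom_mem_lefschetzSimilitudeGroupBaseChange_comapEquiv_iff
    (Γ : (K ⊗[ℚ] W) ≃ₗ[K] (K ⊗[ℚ] W)) :
    glConjHom (e.baseChange ℚ K V W) Γ ∈ (Q.comapEquiv e).lefschetzSimilitudeGroupBaseChange K ↔
      Γ ∈ Q.lefschetzSimilitudeGroupBaseChange K := by
  rw [Q.mem_lefschetzSimilitudeGroupBaseChange_comapEquiv_iff K e]
  have h : (e.baseChange ℚ K V W).symm.trans ((glConjHom (e.baseChange ℚ K V W) Γ).trans (e.baseChange ℚ K V W)) = Γ :=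
    LinearEquiv.ext fun y ↦ by
      simp only [LinearEquiv.trans_apply, glConjHom_apply, LinearEquiv.apply_symm_apply]
  rw [h]

/-- **`S(e^* H)(K) = (1⊗e)⁻¹ S(H)(K) (1⊗e)`** as subgroups of `GL(K ⊗ V)`. [cite: Milne1999LefschetzClasses, §1 p. 644 L16–L21] -/
theorem Polarization.lefschetzGroupBaseChange_comapEquiv_eq_map :
    (Q.comapEquiv e).lefschetzGroupBaseChange K =
      (Q.lefschetzGroupBaseChange K).map (glConjHom (e.baseChange ℚ K V W)) := by
  ext γ
  rw [Subgroup.mem_map]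
  constructor
  · intro hγ
    refine ⟨_, (Q.mem_lefschetzGroupBaseChange_comapEquiv_iff K e γ).1 hγ, LinearEquiv.ext fun x ↦ ?_⟩
    simp only [glConjHom_apply, LinearEquiv.trans_apply, LinearEquiv.symm_apply_apply]
  · rintro ⟨Γ, hΓ, rfl⟩
    exact (Q.glConjHom_mem_lefschetzGroupBaseChange_comapEquiv_iff K e Γ).2 hΓ

/-- **`G(e^* H)(K) = (1⊗e)⁻¹ G(H)(K) (1⊗e)`** as subgroups of `GL(K ⊗ V)`. [cite: Milne1999LefschetzClasses, §4 p. 659 L10–L13] -/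
theorem Polarization.lefschetzSimilitudeGroupBaseChange_comapEquiv_eq_map :
    (Q.comapEquiv e).lefschetzSimilitudeGroupBaseChange K =
      (Q.lefschetzSimilitudeGroupBaseChange K).map (glConjHom (e.baseChange ℚ K V W)) := by
  ext γ
  rw [Subgroup.mem_map]
  constructor
  · intro hγ
    refine ⟨_, (Q.mem_lefschetzSimilitudeGroupBaseChange_comapEquiv_iff K e γ).1 hγ, LinearEquiv.ext fun x ↦ ?_⟩
    simp only [glConjHom_apply, LinearEquiv.trans_apply, LinearEquiv.symm_apply_apply]
  · rintro ⟨Γ, hΓ, rfl⟩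
    exact (Q.glConjHom_mem_lefschetzSimilitudeGroupBaseChange_comapEquiv_iff K e Γ).2 hΓ

/-- **The isomorphism `S(e^* H)(K) ≃ S(H)(K)`, `γ ↦ (1⊗e) γ (1⊗e)⁻¹`** (inverse `Γ ↦ (1⊗e)⁻¹ Γ (1⊗e)`), for every
field `K ⊇ ℚ` — "`S(A)` depends only on the isogeny class of `A` (up to a unique isomorphism)", on `K`-points.
[cite: Milne1999LefschetzClasses, §1 p. 644 L16–L21] -/
def Polarization.lefschetzGroupBaseChangeComapEquivMulEquiv :
    (Q.comapEquiv e).lefschetzGroupBaseChange K ≃* Q.lefschetzGroupBaseChange K where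
  toFun γ := ⟨(e.baseChange ℚ K V W).symm.trans (γ.1.trans (e.baseChange ℚ K V W)),
    (Q.mem_lefschetzGroupBaseChange_comapEquiv_iff K e γ.1).1 γ.2⟩
  invFun Γ := ⟨glConjHom (e.baseChange ℚ K V W) Γ.1,
    (Q.glConjHom_mem_lefschetzGroupBaseChange_comapEquiv_iff K e Γ.1).2 Γ.2⟩
  left_inv γ := Subtype.ext <| LinearEquiv.ext fun x ↦ by
    simp only [glConjHom_apply, LinearEquiv.trans_apply, LinearEquiv.symm_apply_apply]
  right_inv Γ := Subtype.ext <| LinearEquiv.ext fun y ↦ by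
    simp only [LinearEquiv.trans_apply, glConjHom_apply, LinearEquiv.apply_symm_apply]
  map_mul' γ γ' := Subtype.ext <| LinearEquiv.ext fun y ↦ by
    simp only [Subgroup.coe_mul, LinearEquiv.trans_apply, LinearEquiv.mul_apply, LinearEquiv.symm_apply_apply]

/-- `lefschetzGroupBaseChangeComapEquivMulEquiv K Q e γ` acts by `y ↦ (1⊗e) (γ ((1⊗e)⁻¹ y))`.
[cite: Milne1999LefschetzClasses, §1 p. 644 L16–L21] -/
@[simp]
theorem Polarization.coe_lefschetzGroupBaseChangeComapEquivMulEquiv_apply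
    (γ : (Q.comapEquiv e).lefschetzGroupBaseChange K) (y : K ⊗[ℚ] W) :
    ((Q.lefschetzGroupBaseChangeComapEquivMulEquiv K e γ : Q.lefschetzGroupBaseChange K) :
        (K ⊗[ℚ] W) ≃ₗ[K] (K ⊗[ℚ] W)) y = e.baseChange ℚ K V W (γ.1 ((e.baseChange ℚ K V W).symm y)) :=
  rfl

/-- The inverse acts by `x ↦ (1⊗e)⁻¹ (Γ ((1⊗e) x))`. [cite: Milne1999LefschetzClasses, §1 p. 644 L16–L21] -/
@[simp]
theorem Polarization.coe_lefschetzGroupBaseChangeComapEquivMulEquiv_symm_apply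
    (Γ : Q.lefschetzGroupBaseChange K) (x : K ⊗[ℚ] V) :
    (((Q.lefschetzGroupBaseChangeComapEquivMulEquiv K e).symm Γ : (Q.comapEquiv e).lefschetzGroupBaseChange K) :
        (K ⊗[ℚ] V) ≃ₗ[K] (K ⊗[ℚ] V)) x = (e.baseChange ℚ K V W).symm (Γ.1 (e.baseChange ℚ K V W x)) :=
  rfl

/-- **The isomorphism `G(e^* H)(K) ≃ G(H)(K)`, `γ ↦ (1⊗e) γ (1⊗e)⁻¹`**, for every field `K ⊇ ℚ` (an isogeny induces
an isomorphism `(L(A), l(A)) ⥲ (L(B), l(B))`, `L = G` by Thm. 4.4; the multiplier is preserved,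
`forall_comapEquiv_form_baseChange_eq_mul_iff`). [cite: Milne1999LefschetzClasses, §4 p. 659 L10–L13 and Cor. 4.7] -/
def Polarization.lefschetzSimilitudeGroupBaseChangeComapEquivMulEquiv :
    (Q.comapEquiv e).lefschetzSimilitudeGroupBaseChange K ≃* Q.lefschetzSimilitudeGroupBaseChange K where
  toFun γ := ⟨(e.baseChange ℚ K V W).symm.trans (γ.1.trans (e.baseChange ℚ K V W)),
    (Q.mem_lefschetzSimilitudeGroupBaseChange_comapEquiv_iff K e γ.1).1 γ.2⟩
  invFun Γ := ⟨glConjHom (e.baseChange ℚ K V W) Γ.1,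
    (Q.glConjHom_mem_lefschetzSimilitudeGroupBaseChange_comapEquiv_iff K e Γ.1).2 Γ.2⟩
  left_inv γ := Subtype.ext <| LinearEquiv.ext fun x ↦ by
    simp only [glConjHom_apply, LinearEquiv.trans_apply, LinearEquiv.symm_apply_apply]
  right_inv Γ := Subtype.ext <| LinearEquiv.ext fun y ↦ by
    simp only [LinearEquiv.trans_apply, glConjHom_apply, LinearEquiv.apply_symm_apply]
  map_mul' γ γ' := Subtype.ext <| LinearEquiv.ext fun y ↦ by
    simp only [Subgroup.coe_mul, LinearEquiv.trans_apply, LinearEquiv.mul_apply, LinearEquiv.symm_apply_apply]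

/-- `lefschetzSimilitudeGroupBaseChangeComapEquivMulEquiv K Q e γ` acts by `y ↦ (1⊗e) (γ ((1⊗e)⁻¹ y))`.
[cite: Milne1999LefschetzClasses, §4 p. 659 L10–L13] -/
@[simp]
theorem Polarization.coe_lefschetzSimilitudeGroupBaseChangeComapEquivMulEquiv_apply
    (γ : (Q.comapEquiv e).lefschetzSimilitudeGroupBaseChange K) (y : K ⊗[ℚ] W) :
    ((Q.lefschetzSimilitudeGroupBaseChangeComapEquivMulEquiv K e γ : Q.lefschetzSimilitudeGroupBaseChange K) :
        (K ⊗[ℚ] W) ≃ₗ[K] (K ⊗[ℚ] W)) y = e.baseChange ℚ K V W (γ.1 ((e.baseChange ℚ K V W).symm y)) :=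
  rfl

/-- `S(e^* H)(K) ≃ S(H)(K)` is the restriction of `G(e^* H)(K) ≃ G(H)(K)` (same conjugation; `S ≤ G`,
`lefschetzGroupBaseChange_le_lefschetzSimilitudeGroupBaseChange`). [cite: Milne1999LefschetzClasses, §4 p. 659 L28–L31] -/
theorem Polarization.coe_lefschetzSimilitudeGroupBaseChangeComapEquivMulEquiv_inclusion
    (γ : (Q.comapEquiv e).lefschetzGroupBaseChange K) :
    ((Q.lefschetzSimilitudeGroupBaseChangeComapEquivMulEquiv K e
        (Subgroup.inclusion ((Q.comapEquiv e).lefschetzGroupBaseChange_le_lefschetzSimilitudeGroupBaseChange K) γ) :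
          Q.lefschetzSimilitudeGroupBaseChange K) : (K ⊗[ℚ] W) ≃ₗ[K] (K ⊗[ℚ] W)) =
      ((Q.lefschetzGroupBaseChangeComapEquivMulEquiv K e γ : Q.lefschetzGroupBaseChange K) :
        (K ⊗[ℚ] W) ≃ₗ[K] (K ⊗[ℚ] W)) :=
  rfl

/-- **Compatibility with `ℚ`-points** (`g ↦ 1 ⊗ g`, the tree's `glBaseChange`): `(e g e⁻¹)_K = (1⊗e) g_K (1⊗e)⁻¹`,
so the isomorphisms on `ℚ`-points (§2) and on `K`-points commute with `S(ℚ) → S(K)`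
(`lefschetzGroup_le_comap_lefschetzGroupBaseChange`). [cite: Milne1999LefschetzClasses, §1 Remark 1.6 (p. 644)] -/
theorem baseChange_symm_trans_trans (g : V ≃ₗ[ℚ] V) :
    (e.symm.trans (g.trans e)).baseChange ℚ K W W =
      (e.baseChange ℚ K V W).symm.trans ((g.baseChange ℚ K V V).trans (e.baseChange ℚ K V W)) := by
  rw [LinearEquiv.baseChange_trans, LinearEquiv.baseChange_trans, LinearEquiv.baseChange_symm]

/-! #### "up to a unique isomorphism", on `K`-points -/

/-- An automorphism `u` of `H` (`↑u ∈ End_HS(H)`): `u_K Γ u_K⁻¹ = Γ` for every `Γ ∈ GL(K ⊗ W)` commuting with all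
`a_K`, `a ∈ End_HS(H)` (in particular for `Γ ∈ S(H)(K)`, `G(H)(K)`). [cite: Milne1999LefschetzClasses, §1 p. 644 L19–L21] -/
theorem baseChange_symm_trans_trans_eq_self_of_mem_endAlg (u : W ≃ₗ[ℚ] W) (hu : (u : Module.End ℚ W) ∈ H.endAlg)
    {Γ : (K ⊗[ℚ] W) ≃ₗ[K] (K ⊗[ℚ] W)}
    (hΓ : ∀ a : H.endAlg, ∀ y, (a : Module.End ℚ W).baseChange K (Γ y) = Γ ((a : Module.End ℚ W).baseChange K y)) :
    (u.baseChange ℚ K W W).symm.trans (Γ.trans (u.baseChange ℚ K W W)) = Γ := by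
  refine LinearEquiv.ext fun y ↦ ?_
  have h := hΓ ⟨_, hu⟩ ((u.baseChange ℚ K W W).symm y)
  change u.toLinearMap.baseChange K _ = Γ (u.toLinearMap.baseChange K _) at h
  rw [← equivBaseChange_apply, ← equivBaseChange_apply, LinearEquiv.apply_symm_apply] at h
  rw [LinearEquiv.trans_apply, LinearEquiv.trans_apply]
  exact h

/-- **"up to a unique isomorphism"**, on `K`-points: two isomorphisms `e, e' : e^* H = e'^* H ⥲ H` of Hodge structures
induce THE SAME map on every `γ ∈ GL(K ⊗ V)` commuting with the `a_K`, `a ∈ End_HS(e^* H)` (in particular on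
`S(e^* H)(K)` and `G(e^* H)(K)`): `(1⊗e') γ (1⊗e')⁻¹ = (1⊗e) γ (1⊗e)⁻¹`. [cite: Milne1999LefschetzClasses, §1 p. 644 L19–L21] -/
theorem baseChange_symm_trans_trans_eq_of_comapEquiv_eq {e e' : V ≃ₗ[ℚ] W} (h : H.comapEquiv e = H.comapEquiv e')
    {γ : (K ⊗[ℚ] V) ≃ₗ[K] (K ⊗[ℚ] V)}
    (hγ : ∀ a : (H.comapEquiv e).endAlg, ∀ x,
      (a : Module.End ℚ V).baseChange K (γ x) = γ ((a : Module.End ℚ V).baseChange K x)) :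
    (e'.baseChange ℚ K V W).symm.trans (γ.trans (e'.baseChange ℚ K V W)) =
      (e.baseChange ℚ K V W).symm.trans (γ.trans (e.baseChange ℚ K V W)) := by
  have he : e' = e.trans (e.symm.trans e') :=
    LinearEquiv.ext fun v ↦ by simp only [LinearEquiv.trans_apply, LinearEquiv.symm_apply_apply]
  rw [he, LinearEquiv.baseChange_trans]
  have h1 : ((e.baseChange ℚ K V W).trans ((e.symm.trans e').baseChange ℚ K W W)).symm.trans
      (γ.trans ((e.baseChange ℚ K V W).trans ((e.symm.trans e').baseChange ℚ K W W))) =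
      ((e.symm.trans e').baseChange ℚ K W W).symm.trans
        (((e.baseChange ℚ K V W).symm.trans (γ.trans (e.baseChange ℚ K V W))).trans
          ((e.symm.trans e').baseChange ℚ K W W)) :=
    LinearEquiv.ext fun y ↦ by simp only [LinearEquiv.trans_apply, LinearEquiv.symm_trans_apply]
  rw [h1]
  exact baseChange_symm_trans_trans_eq_self_of_mem_endAlg K (e.symm.trans e')
    (coe_symm_trans_mem_endAlg_of_comapEquiv_eq H h) ((forall_endAlg_comapEquiv_baseChange_apply_iff K e γ).1 hγ)

/-- The subgroup `S(e^* H)(K) ≤ GL(K ⊗ V)` depends only on the Hodge structure `e^* H`: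
`e^* H = e'^* H` ⇒ `S_{e^* Q}(K) = S_{e'^* Q}(K)`. [cite: Milne1999LefschetzClasses, §1 p. 644 L16–L21] -/
theorem Polarization.lefschetzGroupBaseChange_comapEquiv_eq_of_comapEquiv_eq {e e' : V ≃ₗ[ℚ] W}
    (h : H.comapEquiv e = H.comapEquiv e') :
    (Q.comapEquiv e).lefschetzGroupBaseChange K = (Q.comapEquiv e').lefschetzGroupBaseChange K := by
  ext γ
  rw [Q.mem_lefschetzGroupBaseChange_comapEquiv_iff K e, Q.mem_lefschetzGroupBaseChange_comapEquiv_iff K e']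
  constructor
  · intro hγ
    have hc := (forall_endAlg_comapEquiv_baseChange_apply_iff K e γ).2 hγ.1
    rwa [baseChange_symm_trans_trans_eq_of_comapEquiv_eq K h hc]
  · intro hγ
    have hc := (forall_endAlg_comapEquiv_baseChange_apply_iff K e' γ).2 hγ.1
    rwa [baseChange_symm_trans_trans_eq_of_comapEquiv_eq K h.symm hc]

/-- The subgroup `G(e^* H)(K) ≤ GL(K ⊗ V)` depends only on `e^* H`: `e^* H = e'^* H` ⇒ `G_{e^* Q}(K) = G_{e'^* Q}(K)`.
[cite: Milne1999LefschetzClasses, §4 p. 659 L10–L13] -/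
theorem Polarization.lefschetzSimilitudeGroupBaseChange_comapEquiv_eq_of_comapEquiv_eq {e e' : V ≃ₗ[ℚ] W}
    (h : H.comapEquiv e = H.comapEquiv e') :
    (Q.comapEquiv e).lefschetzSimilitudeGroupBaseChange K = (Q.comapEquiv e').lefschetzSimilitudeGroupBaseChange K := by
  ext γ
  rw [Q.mem_lefschetzSimilitudeGroupBaseChange_comapEquiv_iff K e,
    Q.mem_lefschetzSimilitudeGroupBaseChange_comapEquiv_iff K e']
  constructor
  · intro hγ
    have hc := (forall_endAlg_comapEquiv_baseChange_apply_iff K e γ).2 hγ.1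
    rwa [baseChange_symm_trans_trans_eq_of_comapEquiv_eq K h hc]
  · intro hγ
    have hc := (forall_endAlg_comapEquiv_baseChange_apply_iff K e' γ).2 hγ.1
    rwa [baseChange_symm_trans_trans_eq_of_comapEquiv_eq K h.symm hc]

/-- The packaged form on `K`-points: the isomorphisms `lefschetzGroupBaseChangeComapEquivMulEquiv K Q e` and
`… K Q e'` agree on underlying automorphisms whenever `e^* H = e'^* H` ("up to a unique isomorphism").
[cite: Milne1999LefschetzClasses, §1 p. 644 L16–L21] -/
theorem Polarization.coe_lefschetzGroupBaseChangeComapEquivMulEquiv_eq_of_comapEquiv_eq {e e' : V ≃ₗ[ℚ] W}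
    (h : H.comapEquiv e = H.comapEquiv e') (γ : (Q.comapEquiv e).lefschetzGroupBaseChange K) :
    ((Q.lefschetzGroupBaseChangeComapEquivMulEquiv K e'
        ⟨γ, (Q.lefschetzGroupBaseChange_comapEquiv_eq_of_comapEquiv_eq K h).le γ.2⟩ : Q.lefschetzGroupBaseChange K) :
          (K ⊗[ℚ] W) ≃ₗ[K] (K ⊗[ℚ] W)) =
      ((Q.lefschetzGroupBaseChangeComapEquivMulEquiv K e γ : Q.lefschetzGroupBaseChange K) :
        (K ⊗[ℚ] W) ≃ₗ[K] (K ⊗[ℚ] W)) :=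
  baseChange_symm_trans_trans_eq_of_comapEquiv_eq K h γ.2.1

/-- The same for `G`. [cite: Milne1999LefschetzClasses, §4 p. 659 L10–L13] -/
theorem Polarization.coe_lefschetzSimilitudeGroupBaseChangeComapEquivMulEquiv_eq_of_comapEquiv_eq {e e' : V ≃ₗ[ℚ] W}
    (h : H.comapEquiv e = H.comapEquiv e') (γ : (Q.comapEquiv e).lefschetzSimilitudeGroupBaseChange K) :
    ((Q.lefschetzSimilitudeGroupBaseChangeComapEquivMulEquiv K e'
        ⟨γ, (Q.lefschetzSimilitudeGroupBaseChange_comapEquiv_eq_of_comapEquiv_eq K h).le γ.2⟩ :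
          Q.lefschetzSimilitudeGroupBaseChange K) : (K ⊗[ℚ] W) ≃ₗ[K] (K ⊗[ℚ] W)) =
      ((Q.lefschetzSimilitudeGroupBaseChangeComapEquivMulEquiv K e γ : Q.lefschetzSimilitudeGroupBaseChange K) :
        (K ⊗[ℚ] W) ≃ₗ[K] (K ⊗[ℚ] W)) :=
  baseChange_symm_trans_trans_eq_of_comapEquiv_eq K h γ.2.1

end Points

end HodgeStructure

end Literature.AlgebraicGeometry.Motives

end
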